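import Summits.ResolutionOfSingularities.ResolutionOfSingularities.Theorems.RadicialJungCleanModelsSufficeGamePointData
import Literature.AlgebraicGeometry.Resolution.BlowupSNC
import Literature.AlgebraicGeometry.Resolution.MonomialOrderReductionUnit
import Literature.AlgebraicGeometry.Resolution.StalkIdealLemmas

/-!
# Route `RadicialJung`, crux `CleanModelsSuffice`, line `Sketch`: the exceptionalisation GAME —
# one round OFF the centre (`stub_gameRoundOff`)

Helper (proof of a registered stub) for the skeleton of
`Summit.ResolutionOfSingularities.ResolutionOfSingularities.Theses.RadicialJung.CleanModelsSuffice`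
(stmt-ResolutionOfSingularities-15883), line `Sketch`: the pointwise data (`GameState.PointData`, file
`…GamePointData`) of the new game state at a point `x` of the blow-up `φ : V' → V` of an admissible
centre `Z` which does NOT lie over `Z`, with the four OFF clauses of the round contract.

There the blow-up is a local isomorphism (`IsBlowup.isIso_stalkMap_of_not_mem_support`), and the
presentation of the old state `S` at `v = φ x` is TRANSPORTED along the stalk isomorphism
`ε : 𝒪_{V,v} ≅ 𝒪_{V',x}`: same embedding dimension, coordinates `ε ∘ u`, same exponents, unit `ε w`,
same generator and radicand (`functionFieldMap_comp`, `functionFieldMap_toFunctionField`). The members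
of the new boundary `E' = E.map (strictTransformIdeal φ C) ++ [C·𝒪_{V'}]` through `x` are never the
exceptional divisor (its stalk at `x` is the unit ideal), hence are strict transforms of old divisors
through `v` (`exists_preimage_divisor`), whose stalks are the extended old stalks
(`stalkIdeal_strictTransformIdeal` with unit exceptional ideal); the correspondence
`K ↦ strictTransformIdeal φ C K` is a bijection between the old divisors through `v` and the new ones
through `x` (injective because distinct members of a regular system of parameters do not divide each
other), and the new labels are the old ones. Consequently all measures agree: `mOld`, the charges and
the resonances of the old divisors, and the exceptional divisor is absent.

* `GameState.RoundOff.stalkIdeal_strictTransformIdeal_eq_map`, `…mem_support_strictTransformIdeal_iff`,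
  `…strictTransformIdeal_injective` — the old/new boundary correspondence off the centre;
* `GameState.RoundOff.exists_pointData` — the transported pointwise data with `mOld`, `oldExp` and the
  exponents of all members of the new boundary computed;
* `stub_gameRoundOff` — the registered stub, verbatim.
-/

noncomputable section

set_option linter.dupNamespace false -- mandated namespace of this single-conjunct summit

open CategoryTheory AlgebraicGeometry TopologicalSpace IsLocalRing
open Literature.AlgebraicGeometry.Resolution Literature.AlgebraicGeometry.Motives

namespace Summit.ResolutionOfSingularities.ResolutionOfSingularities.Theorems.RadicialJung.CleanModelsSuffice

namespace GameState

namespace RoundOff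

/-! ## The stalks of the new boundary off the centre -/

section StalkIso

variable {V V' : Scheme.{0}} {φ : V' ⟶ V} {x : V'} {C : V.IdealSheafData}

/-- Off the centre the exceptional ideal is the unit ideal at `x`. [folklore] -/
theorem stalkIdeal_comap_eq_top (hxC : φ x ∉ C.support) : stalkIdeal (C.comap φ) x = ⊤ := by
  apply stalkIdeal_eq_top_of_not_mem_support
  rwa [Scheme.IdealSheafData.support_comap]

/-- Off the centre no member of the new boundary through `x` is the exceptional divisor. [folklore] -/
theorem ne_comap {E : List V.IdealSheafData} (hxC : φ x ∉ C.support)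
    (D' : {D : V'.IdealSheafData //
      D ∈ E.map (strictTransformIdeal φ C) ++ [C.comap φ] ∧ x ∈ D.support}) :
    D'.1 ≠ C.comap φ := by
  intro h
  have hle := (mem_support_iff_stalkIdeal_le _ _).mp D'.2.2
  rw [h, stalkIdeal_comap_eq_top hxC, top_le_iff] at hle
  exact (maximalIdeal.isMaximal _).ne_top hle

variable [IsLocallyNoetherian V'] {ε : V.presheaf.stalk (φ x) ≃+* V'.presheaf.stalk x}

/-- **Off the centre the stalk of a strict transform is the extended old stalk**:
`(φ^s K)_x = ε (K_{φ x})` for the stalk isomorphism `ε = φ_x^#`. [folklore] -/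
theorem stalkIdeal_strictTransformIdeal_eq_map (hε : ∀ a, ε a = (φ.stalkMap x).hom a)
    (hxC : φ x ∉ C.support) (K : V.IdealSheafData) :
    stalkIdeal (strictTransformIdeal φ C K) x = (stalkIdeal K (φ x)).map ε := by
  rw [stalkIdeal_strictTransformIdeal, stalkIdeal_comap_eq_top hxC]
  have hpow : ∀ n : ℕ, ((⊤ : Ideal (V'.presheaf.stalk x)) ^ n : Ideal _) = ⊤ := fun n => by simp
  simp_rw [hpow, Submodule.top_coe, Submodule.colon_univ]
  rw [iSup_const]
  unfold Ideal.map
  congr 1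
  exact Set.image_congr' fun a => (hε a).symm

/-- Off the centre, `x` lies on the strict transform of `K` iff `φ x` lies on `K`. [folklore] -/
theorem mem_support_strictTransformIdeal_iff (hε : ∀ a, ε a = (φ.stalkMap x).hom a)
    (hxC : φ x ∉ C.support) (K : V.IdealSheafData) :
    x ∈ (strictTransformIdeal φ C K).support ↔ φ x ∈ K.support := by
  refine ⟨mem_support_of_mem_support_strictTransformIdeal, fun h => ?_⟩
  rw [mem_support_iff_stalkIdeal_le, stalkIdeal_strictTransformIdeal_eq_map hε hxC,
    ← map_ringEquiv_maximalIdeal ε]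
  exact Ideal.map_mono ((mem_support_iff_stalkIdeal_le K (φ x)).mp h)

end StalkIso

/-! ## The transported pointwise data -/

section Off

variable {p : ℕ} {V₀ : Scheme.{0}} [IsIntegral V₀] {L : Type} [Field L] [Algebra V₀.functionField L]
  {V : Scheme.{0}} [IsIntegral V] {π : V ⟶ V₀} [IsDominant π] (S : GameState p V₀ L V π)
  {C : V.IdealSheafData} {V' : Scheme.{0}} {φ : V' ⟶ V} {x : V'}

/-- The coordinates of the old state form a regular system of parameters (as an `IsRsopPart`).
[folklore] -/
theorem isRsopPart_u (v : V) : IsRsopPart (S.u v) := by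
  haveI := S.isRegular v
  exact isRsopPart_comp_of_rsop (S.spanFinrank_eq v) (S.u v) (S.span_u v) id Function.injective_id

variable [IsLocallyNoetherian V'] {ε : V.presheaf.stalk (φ x) ≃+* V'.presheaf.stalk x}

/-- **The strict transform is injective on the old divisors through `φ x`** (off the centre): their
stalks at `x` are the extensions of `(u_{lab K})`, and distinct members of a regular system of
parameters do not divide each other. [folklore] -/
theorem strictTransformIdeal_injective (hε : ∀ a, ε a = (φ.stalkMap x).hom a) (hxC : φ x ∉ C.support)
    {K₁ K₂ : {K : V.IdealSheafData // K ∈ S.E ∧ φ x ∈ K.support}}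
    (h : strictTransformIdeal φ C K₁.1 = strictTransformIdeal φ C K₂.1) : K₁ = K₂ := by
  by_contra hne
  have hlab : S.lab (φ x) K₁ ≠ S.lab (φ x) K₂ := fun h' => hne (S.lab_injective _ h')
  have hst := congrArg (fun D => stalkIdeal D x) h
  simp only at hst
  rw [stalkIdeal_strictTransformIdeal_eq_map hε hxC, stalkIdeal_strictTransformIdeal_eq_map hε hxC,
    S.stalkIdeal_lab, S.stalkIdeal_lab, Ideal.map_span, Ideal.map_span, Set.image_singleton,
    Set.image_singleton] at hst
  have hdvd : ε (S.u (φ x) (S.lab (φ x) K₁)) ∣ ε (S.u (φ x) (S.lab (φ x) K₂)) :=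
    Ideal.span_singleton_le_span_singleton.mp hst.symm.le
  have hdvd' := map_dvd ε.symm hdvd
  simp only [RingEquiv.symm_apply_apply] at hdvd'
  exact (isRsopPart_u S (φ x)).not_dvd hlab hdvd'

/-- The strict transform of an old divisor through `φ x` is a member of the new boundary through `x`.
[folklore] -/
theorem strictTransform_mem (hε : ∀ a, ε a = (φ.stalkMap x).hom a) (hxC : φ x ∉ C.support)
    (K : {K : V.IdealSheafData // K ∈ S.E ∧ φ x ∈ K.support}) :
    strictTransformIdeal φ C K.1 ∈ S.E.map (strictTransformIdeal φ C) ++ [C.comap φ] ∧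
      x ∈ (strictTransformIdeal φ C K.1).support :=
  ⟨List.mem_append_left _ (List.mem_map.mpr ⟨K.1, K.2.1, rfl⟩),
    (mem_support_strictTransformIdeal_iff hε hxC K.1).mpr K.2.2⟩

variable [IsIntegral V'] [IsDominant φ] [IsDominant (φ ≫ π)]

omit [IsLocallyNoetherian V'] in
/-- `ε` followed by `𝒪_{V',x} → K(V')` is `𝒪_{V,φ x} → K(V)` followed by `φ^♯`. [folklore] -/
theorem algebraMap_eq_functionFieldMap (hε : ∀ a, ε a = (φ.stalkMap x).hom a)
    (t : V.presheaf.stalk (φ x)) :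
    algebraMap (V'.presheaf.stalk x) V'.functionField (ε t) =
      RatFn.functionFieldMap φ (algebraMap (V.presheaf.stalk (φ x)) V.functionField t) := by
  rw [hε]
  exact (RatFn.functionFieldMap_toFunctionField φ x t).symm

/-- **The transported pointwise data** at a point `x` off the centre: the presentation of `S` at `φ x`
carried along a stalk isomorphism `ε = φ_x^#`, the members of the new boundary through `x` labelled as
their (old) preimages; its `mOld` and `oldExp` are those of `S` at `φ x`, the exponent of the strict
transform of an old divisor is the old exponent, and the exceptional divisor has exponent `0`.
[folklore] -/
theorem exists_pointData (hε : ∀ a, ε a = (φ.stalkMap x).hom a) (hxC : φ x ∉ C.support) :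
    ∃ P : PointData p V₀ L V' (φ ≫ π) (S.E.map (strictTransformIdeal φ C) ++ [C.comap φ]) x,
      P.mOld = S.mOld (φ x) ∧ P.oldExp = S.oldExp (φ x) ∧
      (∀ D ∈ S.E, P.expOf (strictTransformIdeal φ C D) = S.expOf D (φ x)) ∧
      P.expOf (C.comap φ) = 0 := by
  classical
  -- the old divisor through `φ x` under a member of the new boundary through `x` (unique)
  obtain ⟨pre, hpre⟩ : ∃ pre : {D : V'.IdealSheafData //
        D ∈ S.E.map (strictTransformIdeal φ C) ++ [C.comap φ] ∧ x ∈ D.support} →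
      {K : V.IdealSheafData // K ∈ S.E ∧ φ x ∈ K.support},
      ∀ D', strictTransformIdeal φ C (pre D').1 = D'.1 :=
    ⟨fun D' => (exists_preimage_divisor D' (ne_comap hxC D')).choose,
      fun D' => (exists_preimage_divisor D' (ne_comap hxC D')).choose_spec⟩
  have hpre' : ∀ (K : {K : V.IdealSheafData // K ∈ S.E ∧ φ x ∈ K.support}) h,
      pre ⟨strictTransformIdeal φ C K.1, h⟩ = K := fun K h =>
    strictTransformIdeal_injective S hε hxC (hpre ⟨_, h⟩)
  have hmax : (maximalIdeal (V.presheaf.stalk (φ x))).map ε = maximalIdeal (V'.presheaf.stalk x) :=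
    map_ringEquiv_maximalIdeal ε
  haveI := S.isRegular (φ x)
  -- the transported data
  let P : PointData p V₀ L V' (φ ≫ π) (S.E.map (strictTransformIdeal φ C) ++ [C.comap φ]) x :=
    { d := S.d (φ x)
      u := fun i => ε (S.u (φ x) i)
      a := S.a (φ x)
      w := ε (S.w (φ x))
      lab := fun D' => S.lab (φ x) (pre D')
      y := S.y (φ x)
      g := S.g (φ x)
      isRegular := IsRegularLocalRing.of_ringEquiv (R := V.presheaf.stalk (φ x)) ε
      spanFinrank_eq := by
        rw [← hmax, Ideal.spanFinrank_map_eq_of_ringEquiv]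
        exact S.spanFinrank_eq (φ x)
      span_u := by
        rw [← hmax, ← S.span_u (φ x), Ideal.map_span, ← Set.range_comp]
        rfl
      a_spec := S.a_spec (φ x)
      isUnit_w := (S.isUnit_w (φ x)).map ε
      lab_injective := fun D₁ D₂ h => by
        have h' := S.lab_injective _ h
        apply Subtype.ext
        rw [← hpre D₁, ← hpre D₂, h']
      stalkIdeal_lab := fun D' => by
        have hD : stalkIdeal D'.1 x = stalkIdeal (strictTransformIdeal φ C (pre D').1) x := by
          rw [hpre D']
        rw [hD, stalkIdeal_strictTransformIdeal_eq_map hε hxC, S.stalkIdeal_lab, Ideal.map_span,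
          Set.image_singleton]
      y_not_mem := S.y_not_mem (φ x)
      y_pow := S.y_pow (φ x)
      map_g := by
        rw [RatFn.functionFieldMap_comp π φ, RingHom.comp_apply, S.map_g (φ x),
          ← algebraMap_eq_functionFieldMap hε, map_mul, map_prod]
        simp_rw [map_pow]
      reg := fun ha => by
        rcases S.reg (φ x) ha with h | ⟨z₀, hz₁, hz₂⟩
        · refine Or.inl fun z hz => h (ε.symm z) ?_
          rw [← Ideal.apply_mem_of_equiv_iff (f := ε), hmax, map_sub, map_pow,
            RingEquiv.apply_symm_apply]
          exact hz
        · refine Or.inr ⟨ε z₀, ?_, fun hmem => hz₂ ?_⟩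
          · rw [← map_pow, ← map_sub, ← hmax, Ideal.apply_mem_of_equiv_iff]
            exact hz₁
          · rw [← map_pow, ← map_sub] at hmem
            rw [← Ideal.apply_mem_of_equiv_iff (f := ε), Ideal.map_sup, Ideal.map_pow, hmax,
              Ideal.map_span]
            refine (sup_le_sup_left (α := Ideal (V'.presheaf.stalk x)) (Ideal.span_mono ?_) _ :
              _ ≤ _) hmem
            rintro _ ⟨_, ⟨D', rfl⟩, rfl⟩
            exact ⟨S.u (φ x) (S.lab (φ x) (pre D')), ⟨_, ⟨_, rfl⟩, rfl⟩, rfl⟩ }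
  -- the boundary coordinates at `x` are those at `φ x`
  have hIsLab : ∀ i, P.IsLab i ↔ S.IsLab (φ x) i := fun i => by
    unfold PointData.IsLab GameState.IsLab
    constructor
    · rintro ⟨D', rfl⟩
      exact ⟨pre D', rfl⟩
    · rintro ⟨K, rfl⟩
      exact ⟨⟨strictTransformIdeal φ C K.1, strictTransform_mem S hε hxC K⟩,
        congrArg (S.lab (φ x)) (hpre' K (strictTransform_mem S hε hxC K))⟩
  have hOldCh : P.oldCh = S.oldCh (φ x) := by
    unfold PointData.oldCh GameState.oldCh
    exact @Finset.filter_congr _ _ _ (_) (_) _ fun i _ => (hIsLab i).not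
  -- the exponents of the strict transforms
  have hExp : ∀ D ∈ S.E, P.expOf (strictTransformIdeal φ C D) = S.expOf D (φ x) := fun D hD => by
    unfold PointData.expOf GameState.expOf
    by_cases hv : φ x ∈ D.support
    · have h' := strictTransform_mem S hε hxC ⟨D, hD, hv⟩
      rw [dif_pos h', dif_pos ⟨hD, hv⟩]
      exact congrArg (S.a (φ x)) (congrArg (S.lab (φ x)) (hpre' ⟨D, hD, hv⟩ h'))
    · rw [dif_neg (fun h => hv (mem_support_of_mem_support_strictTransformIdeal h.2)),
        dif_neg (fun h => hv h.2)]
  have hx' : x ∉ (C.comap φ).support := by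
    rw [Scheme.IdealSheafData.support_comap]
    exact hxC
  refine ⟨P, congrArg Finset.card hOldCh, congrArg (fun s => Finset.sup s P.a) hOldCh, hExp, ?_⟩
  unfold PointData.expOf
  rw [dif_neg (fun h => hx' h.2)]

end Off

end RoundOff

end GameState

/-! ## The registered stub -/

/-- STUB (game, one round, OFF the centre). At a point `x` of the blow-up not over the centre the
blow-up is a local isomorphism (`IsBlowup.isIso_stalkMap_of_not_mem`); the presentation of `φ x` is transported
along the stalk isomorphism: same coordinates, exponents, unit, generator and radicand; the members of the new
boundary through `x` are the strict transforms (= pull-backs there) of the old divisors through `φ x`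
(`exists_preimage_divisor`, `stalkIdeal_strictTransformIdeal` with unit exceptional ideal), labelled as
before; the exceptional divisor is absent. Hence all measures agree. [folklore] -/
theorem stub_gameRoundOff (p : ℕ) (hp : p.Prime) (k : Type) [Field k] [CharP k p]
    (V₀ : Scheme.{0}) [IsIntegral V₀] (f₀ : V₀ ⟶ Spec (.of k)) (L : Type) [Field L]
    [Algebra V₀.functionField L] [LocallyOfFiniteType f₀] [QuasiCompact f₀]
    (hdeg : Module.finrank V₀.functionField L = p)
    (V : Scheme.{0}) [IsIntegral V] (π : V ⟶ V₀) [IsDominant π] [IsProper π] (hbir : IsBirational π)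
    (S : GameState p V₀ L V π) (Z : Set V) (hZ : IsClosed Z)
    (I : ∀ v : V, v ∈ Z → Finset (Fin (S.d v))) (hadm : S.Admissible Z hZ I)
    (V' : Scheme.{0}) [IsIntegral V'] (φ : V' ⟶ V) [IsDominant (φ ≫ π)]
    (hφ : IsBlowup φ (Scheme.IdealSheafData.vanishingIdeal ⟨Z, hZ⟩)) (x : V') (hx : φ x ∉ Z) :
    ∃ P : GameState.PointData p V₀ L V' (φ ≫ π)
        (S.E.map (strictTransformIdeal φ (Scheme.IdealSheafData.vanishingIdeal ⟨Z, hZ⟩)) ++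
          [(Scheme.IdealSheafData.vanishingIdeal ⟨Z, hZ⟩).comap φ]) x,
      P.mOld = S.mOld (φ x) ∧
      (∀ D ∈ S.E, (P.chargedAt (strictTransformIdeal φ (Scheme.IdealSheafData.vanishingIdeal ⟨Z, hZ⟩) D) ↔
        S.chargedAt D (φ x))) ∧
      ¬ P.chargedAt ((Scheme.IdealSheafData.vanishingIdeal ⟨Z, hZ⟩).comap φ) ∧
      (∀ D ∈ S.E, S.chargedAt D (φ x) →
        P.Nval (strictTransformIdeal φ (Scheme.IdealSheafData.vanishingIdeal ⟨Z, hZ⟩) D) = S.Nval (φ x) D) := by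
  have _ := hp; have _ := hdeg; have _ := hbir; have _ := hadm -- (not needed off the centre)
  have hxC : φ x ∉ (Scheme.IdealSheafData.vanishingIdeal (⟨Z, hZ⟩ : Closeds V)).support := by
    intro h
    apply hx
    have h' : φ x ∈ ((Scheme.IdealSheafData.vanishingIdeal (⟨Z, hZ⟩ : Closeds V)).support : Set V) := h
    rwa [Scheme.IdealSheafData.coe_support_vanishingIdeal] at h'
  -- the blow-up of the locally Noetherian `V` is proper, so `V'` is locally Noetherian
  haveI : IsLocallyNoetherian V := LocallyOfFiniteType.isLocallyNoetherian (π ≫ f₀)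
  haveI : IsProper φ := hφ.isProper
  haveI : IsLocallyNoetherian V' := LocallyOfFiniteType.isLocallyNoetherian φ
  -- the stalk map at `x` is an isomorphism
  haveI : IsIso (φ.stalkMap x) := hφ.isIso_stalkMap_of_not_mem_support hxC
  -- the centre ideal is nonzero (its support misses `φ x`), so the blow-up is birational, hence dominant
  have hCne : Scheme.IdealSheafData.vanishingIdeal (⟨Z, hZ⟩ : Closeds V) ≠ ⊥ := by
    intro hbot
    apply hxC
    rw [hbot, Scheme.IdealSheafData.support_bot]
    trivial
  haveI : IsDominant φ := by
    obtain ⟨U, hU, -, hiso⟩ := hφ.isBirational' hCne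
    haveI : IsDominant U.ι := ⟨by rw [DenseRange, Scheme.Opens.range_ι]; exact hU⟩
    haveI : IsDominant ((φ ⁻¹ᵁ U).ι ≫ φ) := by
      rw [← morphismRestrict_ι]
      infer_instance
    exact IsDominant.of_comp (φ ⁻¹ᵁ U).ι φ
  -- transport along `ε = φ_x^#` and read off the measures
  obtain ⟨P, hmOld, hOldExp, hExp, hExc⟩ := GameState.RoundOff.exists_pointData S
    (ε := (asIso (φ.stalkMap x)).commRingCatIsoToRingEquiv) (fun _ => rfl) hxC
  refine ⟨P, hmOld, fun D hD => ?_, ?_, fun D hD _ => ?_⟩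
  · unfold GameState.PointData.chargedAt GameState.chargedAt
    rw [hExp D hD]
  · unfold GameState.PointData.chargedAt
    rw [hExc]
    exact fun h => h rfl
  · unfold GameState.PointData.Nval GameState.Nval
    rw [hExp D hD, hOldExp]

end Summit.ResolutionOfSingularities.ResolutionOfSingularities.Theorems.RadicialJung.CleanModelsSuffice

end
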